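import Mathlib
import Summits.ValiantsHypothesis.ValiantsHypothesis.Theorems.BarrierLeverPartitionMinorsHitByVPHiddenStatesSymbolic

/-!
# Route BarrierLever — item `PartitionMinorsHitByVP` (stmt-ValiantsHypothesis-19717), line `hidden-states`:
# THE SUPPORT-BIJECTION LEMMA — a table whose hidden points have the rows as supports is good

Helper file (`--supports stmt-ValiantsHypothesis-19717`; cell valiant-natproofs, rung V4, 𝒟-side door (c), registered line
`Cruxes/PartitionMinorsHitByVP/Lines/hidden_states.lean`, lane `stub_universalJoinWide` / `stub_fit`; prover seat val-np-p6 gen 8).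
No definitions. Closes NO item.

THE POINT (memo val-np-p6 g8 «cut-tree certifiability» §3bis). Every explicit-table goodness proof of the line so far (zeta tables,
lonely columns, p8's axis tables, the antipodal tables of `…Antipodal*`) has the same skeleton, isolated here once and for all:
if SOME table puts the hidden point of each column `k` at a point whose SUPPORT `T k = {a : point ≠ 0}` is a row, and `k ↦ T k` is a
bijection onto the rows, then the block-additive matrix of THAT table is nonsingular (`det_ne_zero_of_supports`) — the entry `(i,k)` is
nonzero iff `u i ⊆ T k`, so the matrix is a (weighted, arbitrary-valued) zeta pattern of the inclusion poset of the rows, and a maximal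
counterexample argument kills every linear relation among the columns. Hence generic goodness (`symGood_of_supports`). The VALUES of the
nonzero coordinates are irrelevant: only the zero pattern of the hidden points matters. Since, coordinate by coordinate, the columns whose
hidden point vanishes at `a` form an affinely closed sub-family of the piece, a support bijection is exactly an OBLIVIOUS cut-tree certificate
(the same flat for coordinate `a` at every node); in particular pattern tables can certify no more than `Fit` can.

WHAT THIS IS NOT: no family is certified here; item 19717 OPEN; nothing on crux 14610 or VP ≠ VNP.
-/

set_option linter.dupNamespace false

namespace Summit.ValiantsHypothesis.ValiantsHypothesis.Theorems.BarrierLever.HiddenStates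

open Finset Matrix MvPolynomial

noncomputable section

namespace SymbJoin

variable {h m K r : ℕ}

/-- **THE SUPPORT-BIJECTION LEMMA (numeric form).** If the hidden point of column `k` under the table `tx` has support exactly `T k`,
`T` is injective and every `T k` is a row of `u` (so `u` is a bijection onto the supports), then the block-additive matrix of `tx` is
nonsingular. -/
theorem det_ne_zero_of_supports (u : Fin r → Finset (Fin h)) (e : Fin r → Fin m × Finset (Fin K))
    (tx : Fin m → Option (Fin K) → Fin h → ℂ) (T : Fin r → Finset (Fin h))
    (hT : ∀ k a, (tx (e k).1 none a + ∑ q ∈ (e k).2, tx (e k).1 (some q) a ≠ 0 ↔ a ∈ T k))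
    (hTinj : Function.Injective T) (hTu : ∀ k, ∃ i, u i = T k) :
    (Matrix.of fun i k : Fin r =>
      ∏ a ∈ u i, (tx (e k).1 none a + ∑ q ∈ (e k).2, tx (e k).1 (some q) a)).det ≠ 0 := by
  classical
  -- entries: zero iff the row is not inside the support
  let z : Fin r → Fin h → ℂ := fun k a => tx (e k).1 none a + ∑ q ∈ (e k).2, tx (e k).1 (some q) a
  have hzero : ∀ i k, ¬ (u i ⊆ T k) → ∏ a ∈ u i, z k a = 0 := by
    intro i k hsub
    rw [Finset.not_subset] at hsub
    obtain ⟨a, ha, hna⟩ := hsub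
    apply Finset.prod_eq_zero ha
    by_contra hne
    exact hna ((hT k a).mp hne)
  have hne : ∀ i k, u i ⊆ T k → ∏ a ∈ u i, z k a ≠ 0 := by
    intro i k hsub
    rw [Finset.prod_ne_zero_iff]
    intro a ha
    exact (hT k a).mpr (hsub ha)
  intro hdet
  obtain ⟨α, hαne, hαmul⟩ := Matrix.exists_mulVec_eq_zero_iff.mpr hdet
  apply hαne
  have hrow : ∀ i, ∑ k, α k * ∏ a ∈ u i, z k a = 0 := by
    intro i
    have := congrFun hαmul i
    rw [Matrix.mulVec, dotProduct] at this
    simp only [Matrix.of_apply, Pi.zero_apply] at this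
    rw [← this]
    exact Finset.sum_congr rfl fun k _ => mul_comm _ _
  -- a counterexample of maximal support size
  by_contra hα
  have hex : ∃ k, α k ≠ 0 := by
    by_contra hnone
    push Not at hnone
    exact hα (funext hnone)
  obtain ⟨k₀, hk₀, hmax⟩ := Finset.exists_max_image (Finset.univ.filter fun k => α k ≠ 0) (fun k => (T k).card)
    (by obtain ⟨k, hk⟩ := hex; exact ⟨k, by simp [hk]⟩)
  simp only [Finset.mem_filter, Finset.mem_univ, true_and] at hk₀
  obtain ⟨i₀, hi₀⟩ := hTu k₀
  have hrel := hrow i₀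
  rw [Finset.sum_eq_single k₀] at hrel
  · rcases mul_eq_zero.mp hrel with h' | h'
    · exact hk₀ h'
    · exact hne i₀ k₀ (by rw [hi₀]) h'
  · intro k _ hk
    by_cases hαk : α k = 0
    · rw [hαk, zero_mul]
    by_cases hsub : u i₀ ⊆ T k
    · -- then T k₀ ⊆ T k, and maximality forces T k = T k₀, hence k = k₀
      exfalso
      rw [hi₀] at hsub
      have hle : (T k).card ≤ (T k₀).card := hmax k (by simp [hαk])
      have heq : T k₀ = T k := Finset.eq_of_subset_of_card_le hsub hle
      exact hk (hTinj heq.symm)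
    · rw [hzero i₀ k hsub, mul_zero]
  · intro h'; exact absurd (Finset.mem_univ k₀) h'

/-- **THE SUPPORT-BIJECTION LEMMA (generic form).** Under the hypotheses of `det_ne_zero_of_supports` the configuration is generically
good: `symDet u e ≠ 0`. -/
theorem symGood_of_supports (u : Fin r → Finset (Fin h)) (e : Fin r → Fin m × Finset (Fin K))
    (tx : Fin m → Option (Fin K) → Fin h → ℂ) (T : Fin r → Finset (Fin h))
    (hT : ∀ k a, (tx (e k).1 none a + ∑ q ∈ (e k).2, tx (e k).1 (some q) a ≠ 0 ↔ a ∈ T k))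
    (hTinj : Function.Injective T) (hTu : ∀ k, ∃ i, u i = T k) : symDet u e ≠ 0 :=
  symGood_of_table u e tx (det_ne_zero_of_supports u e tx T hT hTinj hTu)

/-- The most common instance: the supports ARE the rows in order (`T = u`): it suffices that the hidden point of column `k` vanishes
exactly outside `u k`. -/
theorem symGood_of_supports_eq_rows (u : Fin r → Finset (Fin h)) (hu : Function.Injective u) (e : Fin r → Fin m × Finset (Fin K))
    (tx : Fin m → Option (Fin K) → Fin h → ℂ)
    (hT : ∀ k a, (tx (e k).1 none a + ∑ q ∈ (e k).2, tx (e k).1 (some q) a ≠ 0 ↔ a ∈ u k)) : symDet u e ≠ 0 :=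
  symGood_of_supports u e tx u hT hu fun k => ⟨k, rfl⟩

end SymbJoin

end

end Summit.ValiantsHypothesis.ValiantsHypothesis.Theorems.BarrierLever.HiddenStates
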